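import Literature.Probability.LatticeModels.BesselIDebyeAsymptotics
import Mathlib.Analysis.SpecialFunctions.Trigonometric.Sinc
import Mathlib.NumberTheory.ZetaValues
import Mathlib.Analysis.SpecialFunctions.ImproperIntegrals
import Mathlib.Analysis.Calculus.Deriv.MeanValue
import HarnessLib

/-!
# Fröhlich–Spencer's analytic interpolation of `n ↦ I_n(β)` (FS81 Appendix B, (B.12)–(B.14)):
the real line

[FS81, Sect. 6, p. 576] runs the Kosterlitz–Thouless (and, by [FS82, p. 433], the Wilson-action
`U(1)` lattice gauge theory) analysis with the dual Bessel weights `I_n(β)` replaced by a function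
`I_β(φ)` of a REAL (later complex) variable with: (a) `I_β(n) = I_n(β)` for `n ∈ ℤ`; (b) `I_β` even,
positive on the real axis and integrable; (c), (d) analyticity and ratio/derivative bounds in the
strip `|Im φ| ≤ β/2`. Appendix B of [FS81] constructs it as

  `I_β(φ) = L_β(φ) E_β(φ)`,  `E_β(φ) = exp[∑_{n ∈ ℤ} (ln I_β(n) - ln L_β(n)) sin²((φ-n)π)/((φ-n)²π²)]`  (B.14)

with `L_β` the Debye main term of (B.12). This file formalises the construction ON THE REAL LINE
for the tree's `besselI : ℤ → ℝ → ℝ`, on top of `BesselIDebyeAsymptotics` ((B.12) with constant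
`50`):

* `debyeL x φ` — `L_x(φ) = e^{√(x²+φ²) - φ sinh⁻¹(φ/x)}/√(2π√(x²+φ²))`; positive, even, continuous,
  `log_debyeL`; `abs_besselI_div_debyeL_sub_one_le` (`|I_n(x)/L_x(n) - 1| ≤ 50/√(x²+n²)`),
  `abs_log_besselI_sub_log_debyeL_le`; the decay `debyeL_le_exp_neg_abs`
  (`L_x(φ) ≤ e^{x cosh 1}/√(2πx) · e^{-|φ|}`, from the tangent-line bound
  `√(1+w²) - w sinh⁻¹ w ≤ cosh 1 - |w|` of the concave Debye exponent);
* `sincSqKernel u = sinc(πu)²` — the interpolation kernel of (B.14): `0 ≤ K ≤ 1`, `K(k) = [k = 0]`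
  on `ℤ`, `K(u) ≤ 1/(π²u²)`, and the uniform bound `∑_{n ∈ ℤ} K(φ - n) ≤ 7/3`
  (`tsum_sincSqKernel_sub_le`, via `ζ(2) = π²/6`);
* `debyeCorr x n = log I_n(x) - log L_x(n)` — `|c_n| ≤ 100/x` for `x ≥ 100`, bounded for every
  `x > 0`; `debyeLogE x φ = ∑_n c_n K(φ - n)` (absolutely convergent, continuous,
  `|log E_x(φ)| ≤ 250/x` for `x ≥ 100`);
* `besselIInterp x φ = L_x(φ) · exp(debyeLogE x φ)` — FS81's `I_β(φ)`: **(a)** `besselIInterp_intCast`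
  (`I_x(m) = I_m(x)`, `m ∈ ℤ`, `x > 0`); **(b)** `besselIInterp_neg` (even), `besselIInterp_pos`,
  `continuous_besselIInterp`, `integrable_besselIInterp` (`x ≥ 100`); and the two-sided closeness
  `besselIInterp_mem_Icc`: `e^{-250/x} L_x(φ) ≤ I_x(φ) ≤ e^{250/x} L_x(φ)` (`x ≥ 100`, all real `φ`).

What is NOT here: the continuation to the strip `|Im φ| ≤ x/2` and properties (c), (d) of
[FS81, p. 576] ((B.13) `|L_β(φ+ia)| ≤ e^{const a²/β} L_β(φ)` and the `e^{2π|a|}` bounds for `E_β`),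
and the identity `∑_n K(φ - n) = 1` (not needed: the bound `7/3` suffices for (b)–(d)).

## References

* J. Fröhlich, T. Spencer, *The Kosterlitz–Thouless transition in two-dimensional abelian spin
  systems and the Coulomb gas*, Comm. Math. Phys. 81 (1981) 527–602: Sect. 6, conditions (a)–(d),
  p. 576; Appendix B, (B.11)–(B.14), pp. 598–599. [FrohlichSpencerKT1981]
* J. Fröhlich, T. Spencer, *Massless phases and symmetry restoration in abelian gauge theories
  and spin systems*, Comm. Math. Phys. 83 (1982) 411–454, p. 433. [FrohlichSpencerCMP1982]
-/

noncomputable section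

open MeasureTheory Set Filter Real
open scoped Topology BigOperators

namespace Literature.Probability.LatticeModels

/-! ### The Debye main term `L_x(φ)` -/

/-- **Fröhlich–Spencer's main term** `L_β(φ) = (2π)^{-1/2} [β(1+φ²/β²)^{1/2}]^{-1/2}
exp[-φ sinh⁻¹(φ/β) + β(1+φ²/β²)^{1/2}]`, written as
`L_x(φ) = e^{√(x²+φ²) - φ sinh⁻¹(φ/x)} / √(2π √(x²+φ²))` (the leading Debye term of `I_φ(x)`).
[cite: FrohlichSpencerKT1981, Appendix B, (B.12), p. 599] -/
def debyeL (x φ : ℝ) : ℝ :=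
  Real.exp (√(x ^ 2 + φ ^ 2) - φ * Real.arsinh (φ / x)) / √(2 * π * √(x ^ 2 + φ ^ 2))

/-- `L_x(φ) > 0` for `x > 0`. [folklore] -/
theorem debyeL_pos {x : ℝ} (hx : 0 < x) (φ : ℝ) : 0 < debyeL x φ := by
  unfold debyeL
  have : 0 < √(x ^ 2 + φ ^ 2) := Real.sqrt_pos.2 (by positivity)
  positivity

/-- `L_x` is even in `φ`. [cite: FrohlichSpencerKT1981, Appendix B, p. 599] -/
theorem debyeL_neg (x φ : ℝ) : debyeL x (-φ) = debyeL x φ := by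
  unfold debyeL
  rw [neg_div, Real.arsinh_neg]
  ring_nf

/-- `log L_x(φ) = √(x²+φ²) - φ sinh⁻¹(φ/x) - ½ log(2π√(x²+φ²))`. [folklore] -/
theorem log_debyeL {x : ℝ} (hx : 0 < x) (φ : ℝ) :
    Real.log (debyeL x φ) =
      √(x ^ 2 + φ ^ 2) - φ * Real.arsinh (φ / x) - Real.log (2 * π * √(x ^ 2 + φ ^ 2)) / 2 := by
  unfold debyeL
  have hs : 0 < √(x ^ 2 + φ ^ 2) := Real.sqrt_pos.2 (by positivity)
  rw [Real.log_div (Real.exp_pos _).ne' (Real.sqrt_pos.2 (by positivity)).ne', Real.log_exp,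
    Real.log_sqrt (by positivity)]

/-- `L_x` is continuous in `φ` (`x > 0`). [folklore] -/
theorem continuous_debyeL {x : ℝ} (hx : 0 < x) : Continuous (debyeL x) := by
  unfold debyeL
  have h1 : Continuous fun φ : ℝ => √(x ^ 2 + φ ^ 2) := (continuous_const.add (continuous_pow 2)).sqrt
  have h2 : Continuous fun φ : ℝ => φ * Real.arsinh (φ / x) :=
    continuous_id.mul (Real.continuous_arsinh.comp (continuous_id.div_const x))
  refine Continuous.div (Real.continuous_exp.comp (h1.sub h2)) ((continuous_const.mul h1).sqrt)
    fun φ => ?_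
  have hs : 0 < √(x ^ 2 + φ ^ 2) := Real.sqrt_pos.2 (by positivity)
  exact (Real.sqrt_pos.2 (by positivity)).ne'

/-- (B.12) in terms of `L_x`: `|I_n(x)/L_x(n) - 1| ≤ 50/√(x²+n²)` for all `x > 0`, `n ∈ ℤ`.
[cite: FrohlichSpencerKT1981, Appendix B, (B.12), p. 599] -/
theorem abs_besselI_div_debyeL_sub_one_le {x : ℝ} (hx : 0 < x) (n : ℤ) :
    |besselI n x / debyeL x n - 1| ≤ 50 / √(x ^ 2 + n ^ 2) := by
  have h := abs_besselI_mul_debye_sub_one_le hx n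
  have hid : besselI n x / debyeL x n = besselI n x * (√(2 * π * √(x ^ 2 + n ^ 2)) *
      Real.exp (n * Real.arsinh (n / x) - √(x ^ 2 + n ^ 2))) := by
    unfold debyeL
    rw [div_div_eq_mul_div, mul_div_assoc, div_eq_mul_inv, ← Real.exp_neg, neg_sub]
  rwa [hid]

/-- (B.12), logarithmic form: for `x ≥ 100` and `n ∈ ℤ`, `|log I_n(x) - log L_x(n)| ≤ 100/√(x²+n²)`.
[cite: FrohlichSpencerKT1981, Appendix B, (B.12)–(B.14), p. 599] -/
theorem abs_log_besselI_sub_log_debyeL_le {x : ℝ} (hx : 100 ≤ x) (n : ℤ) :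
    |Real.log (besselI n x) - Real.log (debyeL x n)| ≤ 100 / √(x ^ 2 + n ^ 2) := by
  rw [log_debyeL (by linarith) n]
  exact abs_log_besselI_sub_debye_le hx n

/-! ### The `sinc²` (Fejér-type) kernel `K(u) = sinc(πu)²` -/

/-- The interpolation kernel `K(u) = sin²(πu)/(π²u²)` (`K(0) = 1`) of [FS81, (B.14)].
[cite: FrohlichSpencerKT1981, Appendix B, (B.14), p. 599] -/
def sincSqKernel (u : ℝ) : ℝ := Real.sinc (π * u) ^ 2

/-- `K ≥ 0`. [folklore] -/
theorem sincSqKernel_nonneg (u : ℝ) : 0 ≤ sincSqKernel u := sq_nonneg _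

/-- `K ≤ 1`. [folklore] -/
theorem sincSqKernel_le_one (u : ℝ) : sincSqKernel u ≤ 1 := by
  unfold sincSqKernel
  have h := Real.abs_sinc_le_one (π * u)
  rw [← sq_abs]
  nlinarith [abs_nonneg (Real.sinc (π * u))]

/-- `K(0) = 1`. [folklore] -/
@[simp] theorem sincSqKernel_zero : sincSqKernel 0 = 1 := by simp [sincSqKernel, Real.sinc_zero]

/-- `K` is even. [folklore] -/
theorem sincSqKernel_neg (u : ℝ) : sincSqKernel (-u) = sincSqKernel u := by
  simp [sincSqKernel, Real.sinc_neg]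

/-- `K(u) = sin²(πu)/(π²u²)` for `u ≠ 0`. [folklore] -/
theorem sincSqKernel_of_ne_zero {u : ℝ} (hu : u ≠ 0) :
    sincSqKernel u = Real.sin (π * u) ^ 2 / (π ^ 2 * u ^ 2) := by
  unfold sincSqKernel
  rw [Real.sinc_of_ne_zero (mul_ne_zero Real.pi_ne_zero hu)]
  ring

/-- `K(u) ≤ 1/(π²u²)` for `u ≠ 0`. [folklore] -/
theorem sincSqKernel_le_inv_sq {u : ℝ} (hu : u ≠ 0) : sincSqKernel u ≤ 1 / (π ^ 2 * u ^ 2) := by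
  rw [sincSqKernel_of_ne_zero hu]
  gcongr
  exact Real.sin_sq_le_one _

/-- `K(k) = [k = 0]` for `k ∈ ℤ` (the interpolation property). [folklore] -/
theorem sincSqKernel_intCast (k : ℤ) : sincSqKernel k = if k = 0 then 1 else 0 := by
  split_ifs with hk
  · subst hk; simp
  · rw [sincSqKernel_of_ne_zero (by exact_mod_cast hk), mul_comm, Real.sin_int_mul_pi]
    simp

/-- `K` is continuous. [folklore] -/
theorem continuous_sincSqKernel : Continuous sincSqKernel :=
  (Real.continuous_sinc.comp (continuous_const.mul continuous_id)).pow 2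

/-! ### The translates of `K` are uniformly summable: `∑_{n ∈ ℤ} K(φ - n) ≤ 7/3` -/

/-- The centred comparison sequence `b(j)`: `1` at `j = 0, 1`, `1/(π²j²)` for `j ≤ -1`,
`1/(π²(j-1)²)` for `j ≥ 2`. [folklore] -/
def sincSqBound (j : ℤ) : ℝ :=
  if j ≤ -1 then 1 / (π ^ 2 * (j : ℝ) ^ 2) else if j ≤ 1 then 1 else 1 / (π ^ 2 * ((j : ℝ) - 1) ^ 2)

/-- `b(j) ≥ 0`. [folklore] -/
theorem sincSqBound_nonneg (j : ℤ) : 0 ≤ sincSqBound j := by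
  unfold sincSqBound
  split_ifs <;> positivity

/-- `b(0) = b(1) = 1`. [folklore] -/
theorem sincSqBound_of_mem {j : ℤ} (hj : ¬ j ≤ -1) (hj' : j ≤ 1) : sincSqBound j = 1 := by
  unfold sincSqBound
  rw [if_neg hj, if_pos hj']

/-- The off-centre comparison: for `δ ∈ [0,1)` and `j ≤ -1` or `j ≥ 2`,
`1/(π²(δ - j)²) ≤ b(j)` (and `δ - j ≠ 0`). [folklore] -/
theorem inv_sq_le_sincSqBound {δ : ℝ} (hδ0 : 0 ≤ δ) (hδ1 : δ < 1) {j : ℤ} (hj : j ≤ -1 ∨ ¬ j ≤ 1) :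
    δ - j ≠ 0 ∧ 1 / (π ^ 2 * (δ - j) ^ 2) ≤ sincSqBound j := by
  have hπ : 0 < π ^ 2 := by positivity
  unfold sincSqBound
  rcases hj with h1 | h2
  · have hj : (j : ℝ) ≤ -1 := by exact_mod_cast h1
    refine ⟨by intro h; linarith, ?_⟩
    rw [if_pos h1]
    apply one_div_le_one_div_of_le
    · have : (0 : ℝ) < (j : ℝ) ^ 2 := by nlinarith
      positivity
    · apply mul_le_mul_of_nonneg_left _ hπ.le
      nlinarith
  · have h1 : ¬ j ≤ -1 := by omega
    have hj : (2 : ℝ) ≤ j := by exact_mod_cast (show 2 ≤ j by omega)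
    refine ⟨by intro h; linarith, ?_⟩
    rw [if_neg h1, if_neg h2]
    apply one_div_le_one_div_of_le
    · have : (0 : ℝ) < ((j : ℝ) - 1) ^ 2 := by nlinarith
      positivity
    · apply mul_le_mul_of_nonneg_left _ hπ.le
      nlinarith

/-- `K(δ - j) ≤ b(j)` for `δ ∈ [0, 1)`. [folklore] -/
theorem sincSqKernel_sub_le_sincSqBound {δ : ℝ} (hδ0 : 0 ≤ δ) (hδ1 : δ < 1) (j : ℤ) :
    sincSqKernel (δ - j) ≤ sincSqBound j := by
  by_cases h : j ≤ -1 ∨ ¬ j ≤ 1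
  · obtain ⟨hne, hle⟩ := inv_sq_le_sincSqBound hδ0 hδ1 h
    exact (sincSqKernel_le_inv_sq hne).trans hle
  · rw [not_or, not_not] at h
    rw [sincSqBound_of_mem h.1 h.2]
    exact sincSqKernel_le_one _

/-- `∑_j b(j) = 7/3` (`= 2 + 2·ζ(2)/π²`). [folklore] -/
theorem hasSum_sincSqBound : HasSum sincSqBound (7 / 3) := by
  have hz := hasSum_zeta_two
  have hπ : π ^ 2 ≠ 0 := by positivity
  have hz1 : HasSum (fun n : ℕ => 1 / ((n + 1 : ℕ) : ℝ) ^ 2) (π ^ 2 / 6) := by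
    rw [← hasSum_nat_add_iff' 1] at hz
    simpa using hz
  have hz2 : HasSum (fun n : ℕ => (1 / π ^ 2) * (1 / ((n + 1 : ℕ) : ℝ) ^ 2)) (1 / 6) := by
    have h6 : (1 : ℝ) / 6 = (1 / π ^ 2) * (π ^ 2 / 6) := by field_simp
    rw [h6]
    exact hz1.mul_left _
  -- nonnegative indices: b(0) = b(1) = 1, b(n) = 1/(π²(n-1)²) for n ≥ 2
  have hpos : HasSum (fun n : ℕ => sincSqBound n) (2 + 1 / 6) := by
    rw [← hasSum_nat_add_iff' 2]
    have h2 : (fun n : ℕ => sincSqBound ((n + 2 : ℕ) : ℤ)) =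
        fun n : ℕ => (1 / π ^ 2) * (1 / ((n + 1 : ℕ) : ℝ) ^ 2) := by
      funext n
      unfold sincSqBound
      have h1 : ¬ ((n + 2 : ℕ) : ℤ) ≤ -1 := by omega
      have h2 : ¬ ((n + 2 : ℕ) : ℤ) ≤ 1 := by omega
      rw [if_neg h1, if_neg h2, one_div_mul_one_div]
      push_cast
      congr 1
      ring
    rw [h2]
    have hsum : ∑ i ∈ Finset.range 2, sincSqBound (i : ℕ) = 2 := by
      simp [Finset.sum_range_succ, sincSqBound]
      norm_num
    rw [hsum, show (2 + 1 / 6 - 2 : ℝ) = 1 / 6 by norm_num]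
    exact hz2
  -- negative indices: b(-(n+1)) = 1/(π²(n+1)²)
  have hneg : HasSum (fun n : ℕ => sincSqBound (-((n : ℤ) + 1))) (1 / 6) := by
    have h2 : (fun n : ℕ => sincSqBound (-((n : ℤ) + 1))) =
        fun n : ℕ => (1 / π ^ 2) * (1 / ((n + 1 : ℕ) : ℝ) ^ 2) := by
      funext n
      unfold sincSqBound
      have h1 : (-((n : ℤ) + 1)) ≤ -1 := by omega
      rw [if_pos h1, one_div_mul_one_div]
      push_cast
      congr 1
      ring
    rw [h2]
    exact hz2
  have h := HasSum.of_nat_of_neg_add_one hpos hneg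
  convert h using 1
  norm_num

/-- `∑_{n ∈ ℤ} K(φ - n)` converges, and is at most `7/3`, for every real `φ`. [folklore] -/
theorem summable_sincSqKernel_sub (φ : ℝ) : Summable fun n : ℤ => sincSqKernel (φ - n) := by
  set m := ⌊φ⌋ with hm
  have hδ0 : 0 ≤ φ - m := by rw [hm]; linarith [Int.floor_le φ]
  have hδ1 : φ - m < 1 := by rw [hm]; linarith [Int.lt_floor_add_one φ]
  have hs : Summable fun j : ℤ => sincSqKernel (φ - ((m + j : ℤ) : ℝ)) := by
    refine Summable.of_nonneg_of_le (fun j => sincSqKernel_nonneg _) (fun j => ?_) hasSum_sincSqBound.summable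
    have : φ - ((m + j : ℤ) : ℝ) = (φ - m) - j := by push_cast; ring
    rw [this]
    exact sincSqKernel_sub_le_sincSqBound hδ0 hδ1 j
  exact (Equiv.summable_iff (Equiv.addLeft m) (f := fun n : ℤ => sincSqKernel (φ - n))).1 hs

/-- The uniform bound `∑_{n ∈ ℤ} K(φ - n) ≤ 7/3` for every real `φ`. [folklore] -/
theorem tsum_sincSqKernel_sub_le (φ : ℝ) : ∑' n : ℤ, sincSqKernel (φ - n) ≤ 7 / 3 := by
  set m := ⌊φ⌋ with hm
  have hδ0 : 0 ≤ φ - m := by rw [hm]; linarith [Int.floor_le φ]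
  have hδ1 : φ - m < 1 := by rw [hm]; linarith [Int.lt_floor_add_one φ]
  have hle : ∀ j : ℤ, sincSqKernel (φ - ((m + j : ℤ) : ℝ)) ≤ sincSqBound j := fun j => by
    have : φ - ((m + j : ℤ) : ℝ) = (φ - m) - j := by push_cast; ring
    rw [this]
    exact sincSqKernel_sub_le_sincSqBound hδ0 hδ1 j
  have hs : Summable fun j : ℤ => sincSqKernel (φ - ((m + j : ℤ) : ℝ)) :=
    Summable.of_nonneg_of_le (fun j => sincSqKernel_nonneg _) hle hasSum_sincSqBound.summable
  rw [← Equiv.tsum_eq (Equiv.addLeft m)]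
  simp only [Equiv.coe_addLeft]
  calc ∑' j : ℤ, sincSqKernel (φ - ((m + j : ℤ) : ℝ)) ≤ ∑' j : ℤ, sincSqBound j :=
        Summable.tsum_le_tsum hle hs hasSum_sincSqBound.summable
    _ = 7 / 3 := hasSum_sincSqBound.tsum_eq

/-! ### The log-corrections `c_n` and the interpolation `I_x(φ) = L_x(φ) E_x(φ)` -/

/-- The log-correction `c_n(x) = log I_n(x) - log L_x(n)` of [FS81, (B.14)].
[cite: FrohlichSpencerKT1981, Appendix B, (B.14), p. 599] -/
def debyeCorr (x : ℝ) (n : ℤ) : ℝ := Real.log (besselI n x) - Real.log (debyeL x n)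

/-- `c_{-n} = c_n`. [folklore] -/
theorem debyeCorr_neg (x : ℝ) (n : ℤ) : debyeCorr x (-n) = debyeCorr x n := by
  unfold debyeCorr
  rw [besselI_neg_index, Int.cast_neg, debyeL_neg]

/-- `|c_n(x)| ≤ 100/√(x²+n²) ≤ 100/x` for `x ≥ 100`. [cite: FrohlichSpencerKT1981, Appendix B, (B.12), p. 599] -/
theorem abs_debyeCorr_le {x : ℝ} (hx : 100 ≤ x) (n : ℤ) : |debyeCorr x n| ≤ 100 / x := by
  have h := abs_log_besselI_sub_log_debyeL_le hx n
  have hx0 : 0 < x := by linarith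
  have hxs : x ≤ √(x ^ 2 + n ^ 2) := Real.le_sqrt_of_sq_le (by nlinarith)
  calc |debyeCorr x n| ≤ 100 / √(x ^ 2 + n ^ 2) := h
    _ ≤ 100 / x := by gcongr

/-- For every `x > 0` the corrections are bounded in `n`: `|c_n(x)| ≤ 1` as soon as
`√(x²+n²) ≥ 100`, so at most finitely many exceed `1`. [folklore] -/
theorem exists_forall_abs_debyeCorr_le {x : ℝ} (hx : 0 < x) : ∃ M : ℝ, ∀ n : ℤ, |debyeCorr x n| ≤ M := by
  -- beyond |n| ≥ 100 the Debye bound gives |c_n| ≤ 1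
  have htail : ∀ n : ℤ, 100 ≤ |(n : ℝ)| → |debyeCorr x n| ≤ 1 := by
    intro n hn
    have hs100 : (100 : ℝ) ≤ √(x ^ 2 + n ^ 2) := by
      apply Real.le_sqrt_of_sq_le
      have : |(n : ℝ)| ^ 2 = (n : ℝ) ^ 2 := sq_abs _
      nlinarith
    have hs : 0 < √(x ^ 2 + n ^ 2) := by linarith
    have h := abs_besselI_div_debyeL_sub_one_le hx n
    have hε : 50 / √(x ^ 2 + n ^ 2) ≤ 1 / 2 := by
      rw [div_le_div_iff₀ hs (by norm_num)]
      linarith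
    have hlog := abs_log_le_of_abs_sub_one_le h hε
    have hI : 0 < besselI n x := besselI_pos hx n
    have hL : 0 < debyeL x n := debyeL_pos hx n
    rw [Real.log_div hI.ne' hL.ne'] at hlog
    unfold debyeCorr
    calc _ ≤ 2 * (50 / √(x ^ 2 + n ^ 2)) := hlog
      _ ≤ 2 * (1 / 2) := by gcongr
      _ = 1 := by norm_num
  -- the finitely many others
  set S : Finset ℤ := Finset.Icc (-100) 100 with hS
  refine ⟨1 + ∑ k ∈ S, |debyeCorr x k|, fun n => ?_⟩
  by_cases hn : n ∈ S
  · have h1 : |debyeCorr x n| ≤ ∑ k ∈ S, |debyeCorr x k| :=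
      Finset.single_le_sum (f := fun k => |debyeCorr x k|) (fun k _ => abs_nonneg _) hn
    linarith
  · have h100 : 100 ≤ |(n : ℝ)| := by
      rw [hS, Finset.mem_Icc, not_and_or, not_le, not_le] at hn
      rcases hn with h | h
      · have : (n : ℝ) ≤ -101 := by exact_mod_cast (show n ≤ -101 by omega)
        rw [abs_of_neg (by linarith)]; linarith
      · have : (101 : ℝ) ≤ n := by exact_mod_cast (show 101 ≤ n by omega)
        rw [abs_of_pos (by linarith)]; linarith
    have := htail n h100
    have h0 : 0 ≤ ∑ k ∈ S, |debyeCorr x k| := Finset.sum_nonneg fun k _ => abs_nonneg _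
    linarith

/-- The logarithm of Fröhlich–Spencer's correction factor,
`log E_x(φ) = ∑_{n ∈ ℤ} (log I_n(x) - log L_x(n)) · sin²((φ-n)π)/((φ-n)²π²)`.
[cite: FrohlichSpencerKT1981, Appendix B, (B.14), p. 599] -/
def debyeLogE (x φ : ℝ) : ℝ := ∑' n : ℤ, debyeCorr x n * sincSqKernel (φ - n)

/-- **Fröhlich–Spencer's interpolation** `I_x(φ) = L_x(φ) E_x(φ)` of `n ↦ I_n(x)` to real `φ`
(here on the real line; [FS81] continue it to the strip `|Im φ| ≤ x/2`).
[cite: FrohlichSpencerKT1981, Appendix B, (B.14), p. 599] -/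
def besselIInterp (x φ : ℝ) : ℝ := debyeL x φ * Real.exp (debyeLogE x φ)

/-- The series defining `log E_x(φ)` converges absolutely (`x > 0`). [folklore] -/
theorem summable_debyeCorr_mul_sincSqKernel {x : ℝ} (hx : 0 < x) (φ : ℝ) :
    Summable fun n : ℤ => debyeCorr x n * sincSqKernel (φ - n) := by
  obtain ⟨M, hM⟩ := exists_forall_abs_debyeCorr_le hx
  refine Summable.of_norm_bounded ((summable_sincSqKernel_sub φ).mul_left M) fun n => ?_
  rw [Real.norm_eq_abs, abs_mul, abs_of_nonneg (sincSqKernel_nonneg _)]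
  exact mul_le_mul_of_nonneg_right (hM n) (sincSqKernel_nonneg _)

/-- **Property (a)**: the interpolation agrees with `I_n(x)` at the integers:
`I_x(m) = I_m(x)` for `m ∈ ℤ`, `x > 0`. [cite: FrohlichSpencerKT1981, Sect. 6 (a), p. 576; Appendix B, (B.14), p. 599] -/
theorem besselIInterp_intCast {x : ℝ} (hx : 0 < x) (m : ℤ) : besselIInterp x m = besselI m x := by
  have hsum : debyeLogE x m = debyeCorr x m := by
    unfold debyeLogE
    rw [tsum_eq_single m]
    · rw [sub_self, sincSqKernel_zero, mul_one]
    · intro n hn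
      rw [show (m : ℝ) - n = ((m - n : ℤ) : ℝ) by push_cast; ring, sincSqKernel_intCast,
        if_neg (sub_ne_zero.2 (Ne.symm hn)), mul_zero]
  unfold besselIInterp
  rw [hsum, debyeCorr, Real.exp_sub, Real.exp_log (besselI_pos hx m), Real.exp_log (debyeL_pos hx m)]
  field_simp [(debyeL_pos hx m).ne']

/-- **Property (b), evenness**: `I_x(-φ) = I_x(φ)`. [cite: FrohlichSpencerKT1981, Sect. 6 (b), p. 576] -/
theorem besselIInterp_neg (x φ : ℝ) : besselIInterp x (-φ) = besselIInterp x φ := by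
  have hE : debyeLogE x (-φ) = debyeLogE x φ := by
    unfold debyeLogE
    rw [← Equiv.tsum_eq (Equiv.neg ℤ)]
    refine tsum_congr fun n => ?_
    simp only [Equiv.neg_apply, Int.cast_neg, debyeCorr_neg]
    rw [show -φ - -(n : ℝ) = -(φ - n) by ring, sincSqKernel_neg]
  unfold besselIInterp
  rw [hE, debyeL_neg]

/-- **Property (b), positivity**: `I_x(φ) > 0` on the real axis (`x > 0`).
[cite: FrohlichSpencerKT1981, Sect. 6 (b), p. 576] -/
theorem besselIInterp_pos {x : ℝ} (hx : 0 < x) (φ : ℝ) : 0 < besselIInterp x φ :=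
  mul_pos (debyeL_pos hx φ) (Real.exp_pos _)

/-- **The interpolation stays uniformly close to the Debye term**: for `x ≥ 100` and all real `φ`,
`|log E_x(φ)| = |log I_x(φ) - log L_x(φ)| ≤ (7/3)(100/x) ≤ 250/x`.
[cite: FrohlichSpencerKT1981, Appendix B, (B.12)–(B.14), p. 599] -/
theorem abs_debyeLogE_le {x : ℝ} (hx : 100 ≤ x) (φ : ℝ) : |debyeLogE x φ| ≤ 250 / x := by
  have hx0 : 0 < x := by linarith
  have hK := summable_sincSqKernel_sub φ
  have hb : ∀ n : ℤ, ‖debyeCorr x n * sincSqKernel (φ - n)‖ ≤ 100 / x * sincSqKernel (φ - n) := by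
    intro n
    rw [Real.norm_eq_abs, abs_mul, abs_of_nonneg (sincSqKernel_nonneg _)]
    exact mul_le_mul_of_nonneg_right (abs_debyeCorr_le hx n) (sincSqKernel_nonneg _)
  have hs : Summable fun n : ℤ => ‖debyeCorr x n * sincSqKernel (φ - n)‖ :=
    Summable.of_nonneg_of_le (fun n => norm_nonneg _) hb (hK.mul_left _)
  unfold debyeLogE
  calc |∑' n : ℤ, debyeCorr x n * sincSqKernel (φ - n)|
      = ‖∑' n : ℤ, debyeCorr x n * sincSqKernel (φ - n)‖ := (Real.norm_eq_abs _).symm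
    _ ≤ ∑' n : ℤ, ‖debyeCorr x n * sincSqKernel (φ - n)‖ := norm_tsum_le_tsum_norm hs
    _ ≤ ∑' n : ℤ, 100 / x * sincSqKernel (φ - n) := Summable.tsum_le_tsum hb hs (hK.mul_left _)
    _ = 100 / x * ∑' n : ℤ, sincSqKernel (φ - n) := tsum_mul_left
    _ ≤ 100 / x * (7 / 3) := by gcongr; exact tsum_sincSqKernel_sub_le φ
    _ ≤ 250 / x := by
        rw [div_mul_eq_mul_div, div_le_div_iff₀ hx0 hx0]
        nlinarith

/-- Two-sided closeness of the interpolation to the Debye term: for `x ≥ 100` and all real `φ`,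
`e^{-250/x} L_x(φ) ≤ I_x(φ) ≤ e^{250/x} L_x(φ)`. [cite: FrohlichSpencerKT1981, Appendix B, (B.12)–(B.14), p. 599] -/
theorem besselIInterp_mem_Icc {x : ℝ} (hx : 100 ≤ x) (φ : ℝ) :
    besselIInterp x φ ∈ Set.Icc (Real.exp (-(250 / x)) * debyeL x φ) (Real.exp (250 / x) * debyeL x φ) := by
  have hx0 : 0 < x := by linarith
  have h := abs_debyeLogE_le hx φ
  rw [abs_le] at h
  have hL := debyeL_pos hx0 φ
  unfold besselIInterp
  constructor
  · calc Real.exp (-(250 / x)) * debyeL x φ ≤ Real.exp (debyeLogE x φ) * debyeL x φ :=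
          mul_le_mul_of_nonneg_right (Real.exp_le_exp.2 h.1) hL.le
      _ = debyeL x φ * Real.exp (debyeLogE x φ) := mul_comm _ _
  · calc debyeL x φ * Real.exp (debyeLogE x φ) = Real.exp (debyeLogE x φ) * debyeL x φ := mul_comm _ _
      _ ≤ Real.exp (250 / x) * debyeL x φ := mul_le_mul_of_nonneg_right (Real.exp_le_exp.2 h.2) hL.le

/-! ### Continuity of the interpolation -/

/-- The dominating sequence `1` on the window `|n| ≤ 2R + 2`, `4/(π²n²)` outside, is summable.
[folklore] -/
theorem summable_windowBound (R : ℝ) :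
    Summable fun n : ℤ => (if |(n : ℝ)| ≤ 2 * R + 2 then (1 : ℝ) else 4 / (π ^ 2 * (n : ℝ) ^ 2)) := by
  have hg : Summable fun n : ℤ => 4 / (π ^ 2 * (n : ℝ) ^ 2) := by
    have := (Real.summable_one_div_int_pow.2 one_lt_two).mul_left (4 / π ^ 2)
    refine this.congr fun n => ?_
    field_simp
  refine Summable.of_norm_bounded_eventually hg ?_
  rw [Filter.eventually_cofinite]
  refine (Set.finite_Icc (-(⌈2 * R + 2⌉)) ⌈2 * R + 2⌉).subset fun n hn => ?_
  simp only [Set.mem_setOf_eq, Real.norm_eq_abs] at hn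
  rw [Set.mem_Icc]
  by_contra hc
  apply hn
  have hn' : ¬ |(n : ℝ)| ≤ 2 * R + 2 := by
    intro hle
    apply hc
    rw [abs_le] at hle
    constructor
    · have := Int.le_ceil (2 * R + 2)
      have : (-(⌈2 * R + 2⌉ : ℤ) : ℝ) ≤ n := by linarith
      exact_mod_cast this
    · exact Int.cast_le.1 (le_trans hle.2 (Int.le_ceil _))
  rw [if_neg hn']
  exact le_of_eq (abs_of_nonneg (by positivity))

/-- On `[-R, R]` the series for `log E_x` is dominated by a summable sequence. [folklore] -/
theorem continuousOn_debyeLogE {x : ℝ} (hx : 0 < x) (R : ℝ) (hR : 0 ≤ R) :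
    ContinuousOn (debyeLogE x) (Set.Icc (-R) R) := by
  obtain ⟨M, hM⟩ := exists_forall_abs_debyeCorr_le hx
  have hM0 : 0 ≤ M := le_trans (abs_nonneg _) (hM 0)
  -- dominating sequence
  set u : ℤ → ℝ := fun n => M * (if |(n : ℝ)| ≤ 2 * R + 2 then 1 else 4 / (π ^ 2 * (n : ℝ) ^ 2)) with hu
  have hu_sum : Summable u := (summable_windowBound R).mul_left M
  apply continuousOn_tsum (u := u)
  · intro n
    exact (continuous_const.mul (continuous_sincSqKernel.comp (continuous_id.sub continuous_const))).continuousOn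
  · exact hu_sum
  · intro n φ hφ
    rw [Set.mem_Icc] at hφ
    rw [Real.norm_eq_abs, abs_mul, abs_of_nonneg (sincSqKernel_nonneg _), hu]
    apply mul_le_mul (hM n) _ (sincSqKernel_nonneg _) hM0
    split_ifs with h
    · exact sincSqKernel_le_one _
    · push Not at h
      -- |n| > 2R + 2 and |φ| ≤ R ⇒ |φ - n| ≥ |n|/2 ≥ 1
      have hφn : |(n : ℝ)| / 2 ≤ |φ - n| := by
        rcases le_or_gt 0 (n : ℝ) with hn0 | hn0
        · rw [abs_of_nonneg hn0] at h ⊢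
          rw [abs_sub_comm, abs_of_nonneg (by linarith)]
          linarith
        · rw [abs_of_neg hn0] at h ⊢
          rw [abs_of_nonneg (by linarith)]
          linarith
      have hne : φ - n ≠ 0 := by
        intro h0; rw [h0, abs_zero] at hφn; linarith [abs_nonneg (n : ℝ)]
      calc sincSqKernel (φ - n) ≤ 1 / (π ^ 2 * (φ - n) ^ 2) := sincSqKernel_le_inv_sq hne
        _ ≤ 4 / (π ^ 2 * (n : ℝ) ^ 2) := by
            have hn0 : (n : ℝ) ≠ 0 := by
              intro h0; rw [h0, abs_zero] at h; linarith
            rw [div_le_div_iff₀ (by positivity) (by positivity)]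
            have h2 : (n : ℝ) ^ 2 = |(n : ℝ)| ^ 2 := (sq_abs _).symm
            have h3 : (φ - n) ^ 2 = |φ - n| ^ 2 := (sq_abs _).symm
            have h4 : |(n : ℝ)| ^ 2 ≤ 4 * |φ - n| ^ 2 := by nlinarith [abs_nonneg (n : ℝ), abs_nonneg (φ - n)]
            have h5 : π ^ 2 * |(n : ℝ)| ^ 2 ≤ π ^ 2 * (4 * |φ - n| ^ 2) :=
              mul_le_mul_of_nonneg_left h4 (by positivity)
            rw [h2, h3]
            linarith

/-- `log E_x` is continuous on `ℝ` (`x > 0`). [folklore] -/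
theorem continuous_debyeLogE {x : ℝ} (hx : 0 < x) : Continuous (debyeLogE x) := by
  rw [continuous_iff_continuousAt]
  intro φ
  have h := continuousOn_debyeLogE hx (|φ| + 1) (by positivity)
  exact h.continuousAt (Icc_mem_nhds (by linarith [neg_abs_le φ]) (by linarith [le_abs_self φ]))

/-- **Property (b), continuity**: the interpolation `I_x` is continuous on `ℝ` (`x > 0`).
[cite: FrohlichSpencerKT1981, Sect. 6 (b), p. 576] -/
theorem continuous_besselIInterp {x : ℝ} (hx : 0 < x) : Continuous (besselIInterp x) :=
  (continuous_debyeL hx).mul (Real.continuous_exp.comp (continuous_debyeLogE hx))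

/-! ### Decay of `L_x` and integrability of the interpolation -/

/-- The tangent-line (concavity) bound for the Debye exponent
`h(w) = √(1+w²) - w sinh⁻¹ w` (`h'' = -1/√(1+w²) < 0`): `h(w) ≤ cosh 1 - |w|`, with equality at
`w = ± sinh 1`. [folklore] -/
theorem sqrt_one_add_sq_sub_mul_arsinh_le (w : ℝ) :
    √(1 + w ^ 2) - w * Real.arsinh w ≤ Real.cosh 1 - |w| := by
  wlog hw : 0 ≤ w
  · have h := this (-w) (by linarith)
    rw [Real.arsinh_neg, abs_neg, show (-w) ^ 2 = w ^ 2 by ring] at h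
    linarith
  rw [abs_of_nonneg hw]
  set F : ℝ → ℝ := fun v => Real.cosh 1 - v - (√(1 + v ^ 2) - v * Real.arsinh v) with hF
  have hderiv : ∀ v, HasDerivAt F (Real.arsinh v - 1) v := by
    intro v
    have hpos : 0 < 1 + v ^ 2 := by positivity
    have h1 : HasDerivAt (fun v => √(1 + v ^ 2)) (v / √(1 + v ^ 2)) v := by
      have h := ((hasDerivAt_pow 2 v).const_add 1).sqrt hpos.ne'
      refine h.congr_deriv ?_
      simp only [Nat.cast_ofNat, Nat.add_one_sub_one, pow_one]
      field_simp
    have h2 : HasDerivAt (fun v => v * Real.arsinh v) (1 * Real.arsinh v + v * (√(1 + v ^ 2))⁻¹) v :=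
      (hasDerivAt_id v).mul (Real.hasDerivAt_arsinh v)
    have h3 := ((hasDerivAt_const v (Real.cosh 1)).sub (hasDerivAt_id v)).sub (h1.sub h2)
    refine h3.congr_deriv ?_
    rw [div_eq_mul_inv]
    ring
  have hF1 : F (Real.sinh 1) = 0 := by
    simp only [hF]
    rw [Real.arsinh_sinh, show (1 : ℝ) + Real.sinh 1 ^ 2 = Real.cosh 1 ^ 2 by
      rw [Real.cosh_sq]; ring, Real.sqrt_sq (Real.cosh_pos 1).le]
    ring
  have hdiff : Differentiable ℝ F := fun v => (hderiv v).differentiableAt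
  have hcont : Continuous F := hdiff.continuous
  rcases le_total w (Real.sinh 1) with hle | hge
  · have hanti : AntitoneOn F (Set.Iic (Real.sinh 1)) := by
      apply antitoneOn_of_deriv_nonpos (convex_Iic _) hcont.continuousOn hdiff.differentiableOn
      intro v hv
      rw [interior_Iic] at hv
      rw [(hderiv v).deriv]
      have : Real.arsinh v < 1 := by
        rw [← Real.arsinh_sinh 1]; exact Real.arsinh_lt_arsinh.2 hv
      linarith
    have h := hanti (Set.mem_Iic.2 hle) (Set.mem_Iic.2 le_rfl) hle
    rw [hF1] at h
    simp only [hF] at h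
    linarith
  · have hmono : MonotoneOn F (Set.Ici (Real.sinh 1)) := by
      apply monotoneOn_of_deriv_nonneg (convex_Ici _) hcont.continuousOn hdiff.differentiableOn
      intro v hv
      rw [interior_Ici] at hv
      rw [(hderiv v).deriv]
      have : 1 < Real.arsinh v := by
        rw [← Real.arsinh_sinh 1]; exact Real.arsinh_lt_arsinh.2 hv
      linarith
    have h := hmono (Set.mem_Ici.2 le_rfl) (Set.mem_Ici.2 hge) hge
    rw [hF1] at h
    simp only [hF] at h
    linarith

/-- **Exponential decay of the Debye term**: `L_x(φ) ≤ e^{x cosh 1}/√(2πx) · e^{-|φ|}` (`x > 0`).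
[folklore] -/
theorem debyeL_le_exp_neg_abs {x : ℝ} (hx : 0 < x) (φ : ℝ) :
    debyeL x φ ≤ Real.exp (x * Real.cosh 1) / √(2 * π * x) * Real.exp (-|φ|) := by
  unfold debyeL
  have hw := sqrt_one_add_sq_sub_mul_arsinh_le (φ / x)
  have hs : x ≤ √(x ^ 2 + φ ^ 2) := Real.le_sqrt_of_sq_le (by nlinarith)
  have hid1 : √(x ^ 2 + φ ^ 2) = x * √(1 + (φ / x) ^ 2) := by
    rw [show x ^ 2 + φ ^ 2 = x ^ 2 * (1 + (φ / x) ^ 2) by field_simp, Real.sqrt_mul (sq_nonneg x),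
      Real.sqrt_sq hx.le]
  have hexp : √(x ^ 2 + φ ^ 2) - φ * Real.arsinh (φ / x) ≤ x * Real.cosh 1 - |φ| := by
    rw [hid1]
    have h1 : φ * Real.arsinh (φ / x) = x * ((φ / x) * Real.arsinh (φ / x)) := by field_simp
    have h2 : |φ| = x * |φ / x| := by rw [abs_div, abs_of_pos hx]; field_simp
    rw [h1, h2]
    have := mul_le_mul_of_nonneg_left hw hx.le
    nlinarith [this]
  calc Real.exp (√(x ^ 2 + φ ^ 2) - φ * Real.arsinh (φ / x)) / √(2 * π * √(x ^ 2 + φ ^ 2))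
      ≤ Real.exp (x * Real.cosh 1 - |φ|) / √(2 * π * x) := by
        gcongr
    _ = Real.exp (x * Real.cosh 1) / √(2 * π * x) * Real.exp (-|φ|) := by
        rw [sub_eq_add_neg, Real.exp_add]
        ring

/-- `e^{-|φ|}` is integrable on `ℝ`. [folklore] -/
theorem integrable_exp_neg_abs : Integrable (fun φ : ℝ => Real.exp (-|φ|)) := by
  have h1 : IntegrableOn (fun φ : ℝ => Real.exp (-|φ|)) (Set.Ioi 0) :=
    (integrableOn_exp_neg_Ioi 0).congr_fun (fun φ hφ => by
      simp only [Set.mem_Ioi] at hφ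
      rw [abs_of_pos hφ]) measurableSet_Ioi
  have h2 : IntegrableOn (fun φ : ℝ => Real.exp (-|φ|)) (Set.Iic 0) :=
    (integrableOn_exp_Iic 0).congr_fun (fun φ hφ => by
      simp only [Set.mem_Iic] at hφ
      simp [abs_of_nonpos hφ]) measurableSet_Iic
  have := h2.union h1
  rwa [Set.Iic_union_Ioi, integrableOn_univ] at this

/-- **Property (b), integrability**: the interpolation `I_x` is integrable over `ℝ` (`x ≥ 100`).
[cite: FrohlichSpencerKT1981, Sect. 6 (b), p. 576] -/
theorem integrable_besselIInterp {x : ℝ} (hx : 100 ≤ x) : Integrable (besselIInterp x) := by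
  have hx0 : 0 < x := by linarith
  set C := Real.exp (250 / x) * (Real.exp (x * Real.cosh 1) / √(2 * π * x)) with hC
  refine Integrable.mono' (integrable_exp_neg_abs.const_mul C)
    (continuous_besselIInterp hx0).aestronglyMeasurable (ae_of_all _ fun φ => ?_)
  rw [Real.norm_eq_abs, abs_of_pos (besselIInterp_pos hx0 φ)]
  calc besselIInterp x φ ≤ Real.exp (250 / x) * debyeL x φ := (besselIInterp_mem_Icc hx φ).2
    _ ≤ Real.exp (250 / x) * (Real.exp (x * Real.cosh 1) / √(2 * π * x) * Real.exp (-|φ|)) := by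
        gcongr
        exact debyeL_le_exp_neg_abs hx0 φ
    _ = C * Real.exp (-|φ|) := by rw [hC]; ring

end Literature.Probability.LatticeModels
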